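import Mathlib
import Summits.Ventures.FusionMHD.Models.FluxSurfacePolarRayLevelGGJMercier
import HarnessLib

/-!
# Polar-ray chart, LEVEL direction (VII): HALF-LOOP registers for an up–down symmetric surface — every register kernel along the
# glued radius is even and `2π`-periodic in `θ`, so `∫₀^{2π} = 2∫₀^π` with NO integrability hypothesis, and the Mercier register
# form (homogeneous of degree two) may be fed the `[0, π]` registers directly

LADDER-GRIDFUSION (F2 item R2 / F1 on the Cerfon–Freidberg rung), cell `gridfusion`, seat `gridfusion-model-7` (g6), 2026-08-27.
Seventh file of «F2.R2-POLAR-LEVEL-DERIV»; companion of `Models/FluxSurfacePolarRayLevelGGJ{,Mercier}.lean` (conventions and the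
three-column framing stated there once).  ★ #117's program certifies the 32 panels of `[0, π]` and reflects (`LevelPanel.reflect`);
this file is the matching bookkeeping for the SIX Mercier registers of `mercierCriterion_ggjData_iff`.

WHAT IS PROVED ([folklore] calculus):
* §1 `integral_two_pi_eq_two_mul_of_even'` — `2π`-periodic and even ⇒ `∫₀^{2π} f = 2∫₀^π f` with NO integrability hypothesis
  (if `f` is not integrable on `[0, π]` both sides vanish; the Loop file's `integral_two_pi_eq_two_mul_of_even` assumed integrability);
  `integral_rayRadius_kernel_eq_two_mul` — for a flux mirror-symmetric about the horizontal line through the centre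
  (`ψ(R, Z_c − t) = ψ(R, Z_c + t)`, so `ρ_u(−θ) = ρ_u(θ)`) and ANY kernel `k(θ, s)` even and `2π`-periodic in `θ`:
  `∫₀^{2π} k(θ, ρ_u θ) dθ = 2∫₀^π k(θ, ρ_u θ) dθ`.
* §2 `θ`-congruence of the named kernels: if `cos θ′ = cos θ` and the fields agree (`D θ′ s = D θ s`, `D₁ θ′ s = D₁ θ s`,
  `G θ′ s = G θ s`) then `volKernel`, `volKernelDs/D`, `polarKernelDs/D`, `invGradKernel`, `sigmaSqKernel`, `bsqGradKernel`,
  `invBsqKernel` agree at `(θ′, s)` and `(θ, s)` (they contain `θ` only through `cos θ` and the fields) — instances `θ′ = −θ`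
  (`cos_neg`) and `θ′ = θ + 2π` (`cos_add_two_pi`).
* §3 `mercierRegisterForm_smul` (degree-two homogeneity: registers `× a` ⇒ form `× a²`) and
  **`LevelLoop.mercierCriterion_ggjData_iff_half`**: under the hypotheses of `mercierCriterion_ggjData_iff` plus mirror symmetry of
  `ψ` and `θ ↦ −θ`, `θ ↦ θ + 2π` invariance of `D`, `D₁`, `G`: Jardin's criterion (8.134) on the implicit surface ⟺
  `0 < mercierRegisterForm g C (∫₀^π polarKernelDs/D) (∫₀^π volKernelDs/D) (∫₀^π invGradKernel) (∫₀^π sigmaSqKernel) (∫₀^π bsqGradKernel)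
  (∫₀^π invBsqKernel)` — the `[0, π]` registers of a 32-panel program, no doubling needed.
MODELLED / NOT CLAIMED: as in the companion files (ideal MHD, Solov'ev-class profiles; NECESSARY criterion of a MODEL; no value for
any equilibrium).
-/

noncomputable section

open Real Set Filter Topology MeasureTheory intervalIntegral
open Literature.MathematicalPhysics.MHD Literature.MathematicalPhysics.MHD.GradShafranov
  Literature.MathematicalPhysics.MHD.FluxGeometry Literature.MathematicalPhysics.MHD.Mercier.FluxForm

namespace Summit.Ventures.FusionMHD.Models

namespace PolarRay

/-! ## §1 Even + periodic ⇒ `∫₀^{2π} = 2∫₀^π`, unconditionally; kernels along a symmetric glued radius -/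

/-- **EVEN + `2π`-PERIODIC ⇒ `∫₀^{2π} f = 2∫₀^π f`, NO INTEGRABILITY HYPOTHESIS** (if `f` is not interval-integrable on `[0, π]` it is
not on `[0, 2π] ⊇ [0, π]` either and both sides are `0`; if it is, evenness transports integrability to `[−π, 0]`). [folklore] -/
theorem integral_two_pi_eq_two_mul_of_even' {f : ℝ → ℝ} (hper : Function.Periodic f (2 * π)) (heven : ∀ x, f (-x) = f x) :
    ∫ x in (0 : ℝ)..(2 * π), f x = 2 * ∫ x in (0 : ℝ)..π, f x := by
  by_cases h₂ : IntervalIntegrable f volume 0 π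
  · have h₁ : IntervalIntegrable f volume (-π) 0 := by
      have h := (h₂.comp_sub_left 0).symm
      simp only [sub_zero, zero_sub] at h
      have hfun : (fun x => f (-x)) = f := funext heven
      rw [hfun] at h
      exact h
    exact integral_two_pi_eq_two_mul_of_even hper heven h₁ h₂
  · have h₄ : ¬ IntervalIntegrable f volume 0 (2 * π) := fun h =>
      h₂ (h.mono_set (by
        rw [uIcc_of_le pi_pos.le, uIcc_of_le two_pi_pos.le]
        exact Icc_subset_Icc le_rfl (by linarith [pi_pos])))
    rw [intervalIntegral.integral_undef h₂, intervalIntegral.integral_undef h₄, mul_zero]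

/-- **HALF-LOOP FORM FOR ANY KERNEL along the glued radius of a MIRROR-SYMMETRIC flux** (`ψ(R, Z_c − t) = ψ(R, Z_c + t)`, so
`ρ_u(−θ) = ρ_u(θ)`; `k` even and `2π`-periodic in `θ`): `∫₀^{2π} k(θ, ρ_u θ) dθ = 2∫₀^π k(θ, ρ_u θ) dθ` — certify `[0, π]` only.
No integrability hypothesis. [folklore] -/
theorem integral_rayRadius_kernel_eq_two_mul {ψ : ℝ → ℝ → ℝ} {Rc Zc : ℝ} (hsym : ∀ R t : ℝ, ψ R (Zc - t) = ψ R (Zc + t))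
    {k : ℝ → ℝ → ℝ} (hneg : ∀ θ s : ℝ, k (-θ) s = k θ s) (hper : ∀ θ s : ℝ, k (θ + 2 * π) s = k θ s) (u : ℝ) :
    ∫ θ in (0 : ℝ)..(2 * π), k θ (rayRadius ψ Rc Zc u θ) = 2 * ∫ θ in (0 : ℝ)..π, k θ (rayRadius ψ Rc Zc u θ) := by
  refine integral_two_pi_eq_two_mul_of_even' (f := fun θ => k θ (rayRadius ψ Rc Zc u θ)) (fun θ => ?_) (fun θ => ?_)
  · show k (θ + 2 * π) (rayRadius ψ Rc Zc u (θ + 2 * π)) = k θ (rayRadius ψ Rc Zc u θ)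
    rw [periodic_rayRadius ψ Rc Zc u θ, hper]
  · show k (-θ) (rayRadius ψ Rc Zc u (-θ)) = k θ (rayRadius ψ Rc Zc u θ)
    rw [rayRadius_neg_of_symm hsym, hneg]

/-! ## §2 The named kernels see `θ` only through `cos θ` and the fields -/

section congr

variable {g Rc : ℝ} {D D₁ G : ℝ → ℝ → ℝ} {θ θ' s : ℝ}

/-- `volKernel` at `θ′` and `θ` agree when `cos θ′ = cos θ` and `D θ′ s = D θ s`. [folklore] -/
theorem volKernel_congr_theta (hcos : cos θ' = cos θ) (hD : D θ' s = D θ s) : volKernel Rc D θ' s = volKernel Rc D θ s := by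
  unfold volKernel; rw [hcos, hD]

/-- `volKernelDs/D` likewise (`D`, `D₁`). [folklore] -/
theorem volKernelDs_div_congr_theta (hcos : cos θ' = cos θ) (hD : D θ' s = D θ s) (hD₁ : D₁ θ' s = D₁ θ s) :
    volKernelDs Rc D D₁ θ' s / D θ' s = volKernelDs Rc D D₁ θ s / D θ s := by
  unfold volKernelDs; rw [hcos, hD, hD₁]

/-- `polarKernelDs/D` likewise. [folklore] -/
theorem polarKernelDs_div_congr_theta (hcos : cos θ' = cos θ) (hD : D θ' s = D θ s) (hD₁ : D₁ θ' s = D₁ θ s) :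
    polarKernelDs Rc D D₁ θ' s / D θ' s = polarKernelDs Rc D D₁ θ s / D θ s := by
  unfold polarKernelDs; rw [hcos, hD, hD₁]

/-- `invGradKernel` likewise (`D`, `G`). [folklore] -/
theorem invGradKernel_congr_theta (hcos : cos θ' = cos θ) (hD : D θ' s = D θ s) (hG : G θ' s = G θ s) :
    invGradKernel Rc D G θ' s = invGradKernel Rc D G θ s := by
  unfold invGradKernel; rw [volKernel_congr_theta hcos hD, hG]

/-- `sigmaSqKernel` likewise. [folklore] -/
theorem sigmaSqKernel_congr_theta (hcos : cos θ' = cos θ) (hD : D θ' s = D θ s) (hG : G θ' s = G θ s) :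
    sigmaSqKernel g Rc D G θ' s = sigmaSqKernel g Rc D G θ s := by
  unfold sigmaSqKernel; rw [volKernel_congr_theta hcos hD, hcos, hG]

/-- `bsqGradKernel` likewise. [folklore] -/
theorem bsqGradKernel_congr_theta (hcos : cos θ' = cos θ) (hD : D θ' s = D θ s) (hG : G θ' s = G θ s) :
    bsqGradKernel g Rc D G θ' s = bsqGradKernel g Rc D G θ s := by
  unfold bsqGradKernel; rw [volKernel_congr_theta hcos hD, hcos, hG]

/-- `invBsqKernel` likewise. [folklore] -/
theorem invBsqKernel_congr_theta (hcos : cos θ' = cos θ) (hD : D θ' s = D θ s) (hG : G θ' s = G θ s) :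
    invBsqKernel g Rc D G θ' s = invBsqKernel g Rc D G θ s := by
  unfold invBsqKernel; rw [volKernel_congr_theta hcos hD, hcos, hG]

end congr

/-! ## §3 The criterion with `[0, π]` registers -/

/-- Degree-two homogeneity of the register form: scaling all six registers by `a` scales the form by `a²`. [cite: Jardin2010, §8.5.4 eq. (8.134)] -/
theorem mercierRegisterForm_smul (g C a Pd Wd Aσ As AB Ai : ℝ) :
    mercierRegisterForm g C (a * Pd) (a * Wd) (a * Aσ) (a * As) (a * AB) (a * Ai)
      = a ^ 2 * mercierRegisterForm g C Pd Wd Aσ As AB Ai := by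
  unfold mercierRegisterForm; ring

namespace LevelLoop

variable {ψ : ℝ → ℝ → ℝ} {Rc Zc uin uout : ℝ} {D D₁ G : ℝ → ℝ → ℝ} {N : ℕ} {t σ₁ σ₂ : ℕ → ℝ}
  {L : ℝ → ℝ → (ℝ × ℝ →L[ℝ] ℝ)}

/-- **JARDIN'S MERCIER CRITERION (8.134) ON AN UP–DOWN SYMMETRIC IMPLICIT SURFACE ⟺ ONE POLYNOMIAL INEQUALITY IN SIX `[0, π]`
REGISTERS.**  Hypotheses of `mercierCriterion_ggjData_iff`, plus: `ψ` mirror-symmetric about the horizontal line through the centre,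
and the fields `D`, `D₁`, `G` invariant under `θ ↦ −θ` and `θ ↦ θ + 2π`.  Then
`MercierCriterion (ggjData g C ψ R_c Z_c u) ↔ 0 < mercierRegisterForm g C (∫₀^π polarKernelDs/D) (∫₀^π volKernelDs/D)
(∫₀^π invGradKernel) (∫₀^π sigmaSqKernel) (∫₀^π bsqGradKernel) (∫₀^π invBsqKernel)` along `ρ_u` — the registers of a program on
`[0, π]` (★ #117's 32 panels), fed in without doubling (the form is homogeneous of degree two).  NECESSARY criterion of the MODEL;
no value claimed. [cite: Jardin2010, §8.5.4 eq. (8.134)] -/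
theorem mercierCriterion_ggjData_iff_half (Λ : LevelLoop ψ Rc Zc uin uout D N t σ₁ σ₂) (g : ℝ) {C : ℝ}
    (hψ : ∀ j < N, ∀ θ ∈ Icc (t j) (t (j + 1)), ∀ s ∈ Icc (σ₁ j) (σ₂ j),
      HasFDerivAt (fun p : ℝ × ℝ => ψ p.1 p.2) (L θ s) (rayPoint Rc Zc θ s))
    (hR : ∀ j < N, ∀ θ ∈ Icc (t j) (t (j + 1)), ∀ s ∈ Icc (σ₁ j) (σ₂ j), 0 < Rc + s * cos θ)
    (hD₁ : ∀ j < N, ∀ θ ∈ Icc (t j) (t (j + 1)), ∀ s ∈ Icc (σ₁ j) (σ₂ j), HasDerivAt (D θ) (D₁ θ s) s)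
    (hD₁c : ∀ j < N, ContinuousOn (fun p : ℝ × ℝ => D₁ p.1 p.2) (Icc (t j) (t (j + 1)) ×ˢ Icc (σ₁ j) (σ₂ j)))
    (hG : ∀ j < N, ∀ θ ∈ Icc (t j) (t (j + 1)), ∀ s ∈ Icc (σ₁ j) (σ₂ j), (L θ s (1, 0)) ^ 2 + (L θ s (0, 1)) ^ 2 = G θ s)
    (hGS : ∀ j < N, ∀ θ ∈ Icc (t j) (t (j + 1)), ∀ s ∈ Icc (σ₁ j) (σ₂ j),
      gsOperator ψ (Rc + s * cos θ) (Zc + s * sin θ) = C * (Rc + s * cos θ) ^ 2)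
    (hsym : ∀ R z : ℝ, ψ R (Zc - z) = ψ R (Zc + z))
    (hDneg : ∀ θ s : ℝ, D (-θ) s = D θ s) (hDper : ∀ θ s : ℝ, D (θ + 2 * π) s = D θ s)
    (hD₁neg : ∀ θ s : ℝ, D₁ (-θ) s = D₁ θ s) (hD₁per : ∀ θ s : ℝ, D₁ (θ + 2 * π) s = D₁ θ s)
    (hGneg : ∀ θ s : ℝ, G (-θ) s = G θ s) (hGper : ∀ θ s : ℝ, G (θ + 2 * π) s = G θ s)
    {u : ℝ} (hu : u ∈ Ioo uin uout) :
    (ggjData g C ψ Rc Zc u).MercierCriterion ↔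
      0 < mercierRegisterForm g C
          (∫ θ in (0 : ℝ)..π, polarKernelDs Rc D D₁ θ (rayRadius ψ Rc Zc u θ) / D θ (rayRadius ψ Rc Zc u θ))
          (∫ θ in (0 : ℝ)..π, volKernelDs Rc D D₁ θ (rayRadius ψ Rc Zc u θ) / D θ (rayRadius ψ Rc Zc u θ))
          (∫ θ in (0 : ℝ)..π, invGradKernel Rc D G θ (rayRadius ψ Rc Zc u θ))
          (∫ θ in (0 : ℝ)..π, sigmaSqKernel g Rc D G θ (rayRadius ψ Rc Zc u θ))
          (∫ θ in (0 : ℝ)..π, bsqGradKernel g Rc D G θ (rayRadius ψ Rc Zc u θ))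
          (∫ θ in (0 : ℝ)..π, invBsqKernel g Rc D G θ (rayRadius ψ Rc Zc u θ)) := by
  rw [Λ.mercierCriterion_ggjData_iff g hψ hR hD₁ hD₁c hG hGS hu]
  have hcn : ∀ θ : ℝ, cos (-θ) = cos θ := fun θ => cos_neg θ
  have hcp : ∀ θ : ℝ, cos (θ + 2 * π) = cos θ := fun θ => cos_add_two_pi θ
  rw [integral_rayRadius_kernel_eq_two_mul hsym (k := fun θ s => polarKernelDs Rc D D₁ θ s / D θ s)
      (fun θ s => polarKernelDs_div_congr_theta (hcn θ) (hDneg θ s) (hD₁neg θ s))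
      (fun θ s => polarKernelDs_div_congr_theta (hcp θ) (hDper θ s) (hD₁per θ s)) u,
    integral_rayRadius_kernel_eq_two_mul hsym (k := fun θ s => volKernelDs Rc D D₁ θ s / D θ s)
      (fun θ s => volKernelDs_div_congr_theta (hcn θ) (hDneg θ s) (hD₁neg θ s))
      (fun θ s => volKernelDs_div_congr_theta (hcp θ) (hDper θ s) (hD₁per θ s)) u,
    integral_rayRadius_kernel_eq_two_mul hsym (k := fun θ s => invGradKernel Rc D G θ s)
      (fun θ s => invGradKernel_congr_theta (hcn θ) (hDneg θ s) (hGneg θ s))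
      (fun θ s => invGradKernel_congr_theta (hcp θ) (hDper θ s) (hGper θ s)) u,
    integral_rayRadius_kernel_eq_two_mul hsym (k := fun θ s => sigmaSqKernel g Rc D G θ s)
      (fun θ s => sigmaSqKernel_congr_theta (hcn θ) (hDneg θ s) (hGneg θ s))
      (fun θ s => sigmaSqKernel_congr_theta (hcp θ) (hDper θ s) (hGper θ s)) u,
    integral_rayRadius_kernel_eq_two_mul hsym (k := fun θ s => bsqGradKernel g Rc D G θ s)
      (fun θ s => bsqGradKernel_congr_theta (hcn θ) (hDneg θ s) (hGneg θ s))
      (fun θ s => bsqGradKernel_congr_theta (hcp θ) (hDper θ s) (hGper θ s)) u,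
    integral_rayRadius_kernel_eq_two_mul hsym (k := fun θ s => invBsqKernel g Rc D G θ s)
      (fun θ s => invBsqKernel_congr_theta (hcn θ) (hDneg θ s) (hGneg θ s))
      (fun θ s => invBsqKernel_congr_theta (hcp θ) (hDper θ s) (hGper θ s)) u,
    mercierRegisterForm_smul]
  have h4 : (0 : ℝ) < 2 ^ 2 := by norm_num
  exact ⟨fun h => pos_of_mul_pos_right h h4.le, fun h => mul_pos h4 h⟩

end LevelLoop

end PolarRay

end Summit.Ventures.FusionMHD.Models

end
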